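import Literature.NumberTheory.DiophantineApproximation.RhinViolaDoubleResidueHL
import HarnessLib

/-!
# The `λ`-conjugate linear decompositions of the Rhin–Viola integrals

Topic `Literature/NumberTheory/DiophantineApproximation`. Everything here is PROVED (no definitions, no named
facts). Source: G. Rhin, C. Viola, *The permutation group method for the dilogarithm*, Ann. Sc. Norm. Super.
Pisa Cl. Sci. (5) 4 (2005) 389–437, proof of Theorem 2.1, p. 408 and p. 409: "If `km = 0` but `jl > 0`, we use
the invariance of (2.2), (2.3), (2.4) … under the action of the permutation `λ`, and then apply the linear
decomposition (2.29). Therefore, if Theorem 2.1 holds for `(h, j−1, k, l−1, m)` and `(h, j−1, k+1, l−1, m)`, it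
holds also for `(h, j, k, l, m)`", and likewise "If `hl = 0` but `hk > 0`, we apply first the permutation `λ` and
then the linear decomposition (2.41). Hence if Theorem 2.1 holds for `(h−1, j, k−1, l, m)`, `(h−1, j, k, l, m)` and
`(h−1, j+1, k−1, l, m)`, it holds also for `(h, j, k, l, m)`."

**A shorter road (design note).** Conjugating (2.29) and (2.41) by `λ = (jm)(kl)` gives the two decompositions

* (2.29)' (`j, l ≥ 1`): `I(h,j,k,l,m) = z^{−1} I(h,j−1,k,l−1,m) − I(h,j−1,k+1,l−1,m)`,
* (2.41)' (`h, k ≥ 1`): `I(h,j,k,l,m) = I(h−1,j,k−1,l,m) − (z−1) I(h−1,j,k,l,m) − I(h−1,j+1,k−1,l,m)`,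

and these are THEMSELVES elementary pointwise identities of the integrands — (2.29)' is `x(1−y) = D − yz` and
(2.41)' is `(1−x)y = D − (z−1)y − x`, `D = x(1−y)+yz` — so they hold for each of `I^{(0)}, I^{(1)}, I^{(2)}` and
`I = I^{(0)} − (log z) I^{(1)}` directly, with no appeal to the `λ`-invariance (2.6) of the contour members
`I^{(1)}, I^{(2)}` (which is not in the tree; `I0_lam` is). This file proves them in the tree's vocabulary
(`RhinViola.integrand/I0`, `innerRes/I1/I`, `I2` in residue form), mirroring `I0_succ_k_succ_m`,
`one_sub_mul_innerRes_succ_l`, `I2_succ_h_succ_l`.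

## References

* G. Rhin, C. Viola, Ann. Sc. Norm. Super. Pisa Cl. Sci. (5) 4 (2005) 389–437, (2.29), (2.41), pp. 408–409.
  [RhinViola2005]
-/

noncomputable section

namespace Literature.NumberTheory.DiophantineApproximation

namespace RhinViola

open _root_.MeasureTheory _root_.Set intervalIntegral Finset Polynomial
open ViolaZudilin (unitSquare denom₁ measurableSet_unitSquare)

/-! ### (2.29)' and (2.41)' for `I_z^{(0)}` -/

/-- Pointwise (2.29)' (`x(1−y) = D − yz`):
`integrand(h,j+1,k,l+1,m) = integrand(h,j,k,l,m) − z·integrand(h,j,k+1,l,m)`. [cite: RhinViola2005, (2.29) and p. 408] -/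
theorem integrand_succ_j_succ_l (z : ℝ) (h j k l m : ℕ) (p : ℝ × ℝ) :
    integrand z h (j + 1) k (l + 1) m p = integrand z h j k l m p - z * integrand z h j (k + 1) l m p := by
  unfold integrand
  by_cases hD : denom₁ z p = 0
  · simp [hD]
  · rw [show j + 1 + k + 1 = j + k + 1 + 1 by ring, show j + (k + 1) + 1 = j + k + 1 + 1 by ring]
    unfold denom₁ at hD ⊢
    field_simp
    ring

/-- Pointwise (2.41)' (`(1−x)y = D − (z−1)y − x`):
`integrand(h+1,j,k+1,l,m) = integrand(h,j,k,l,m) − (z−1)·integrand(h,j,k+1,l,m) − integrand(h,j+1,k,l,m)`.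
[cite: RhinViola2005, (2.41) and p. 409] -/
theorem integrand_succ_h_succ_k (z : ℝ) (h j k l m : ℕ) (p : ℝ × ℝ) :
    integrand z (h + 1) j (k + 1) l m p = integrand z h j k l m p
      - (z - 1) * integrand z h j (k + 1) l m p - integrand z h (j + 1) k l m p := by
  unfold integrand
  by_cases hD : denom₁ z p = 0
  · simp [hD]
  · rw [show j + (k + 1) + 1 = j + k + 1 + 1 by ring, show j + 1 + k + 1 = j + k + 1 + 1 by ring]
    unfold denom₁ at hD ⊢
    field_simp
    ring

/-- **(2.29)' for `I_z^{(0)}`** (`z ≥ 1`): `I0(h,j+1,k,l+1,m) = z^{−1} I0(h,j,k,l,m) − I0(h,j,k+1,l,m)`.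
[cite: RhinViola2005, (2.29) and p. 408] -/
theorem I0_succ_j_succ_l {z : ℝ} (hz : 1 ≤ z) (h j k l m : ℕ) :
    I0 z h (j + 1) k (l + 1) m = z⁻¹ * I0 z h j k l m - I0 z h j (k + 1) l m := by
  have hz0 : z ≠ 0 := by positivity
  have h1 := integrableOn_integrand hz h j k l m
  have h2 := integrableOn_integrand hz h j (k + 1) l m
  have hint : ∫ p in unitSquare, integrand z h (j + 1) k (l + 1) m p =
      (∫ p in unitSquare, integrand z h j k l m p) - z * ∫ p in unitSquare, integrand z h j (k + 1) l m p := by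
    rw [← MeasureTheory.integral_const_mul, ← integral_sub h1 (h2.const_mul z)]
    exact setIntegral_congr_fun measurableSet_unitSquare fun p _ => integrand_succ_j_succ_l z h j k l m p
  have p1 : z ^ (-(((l + 1 : ℕ) : ℤ) + (m : ℤ))) = z⁻¹ * z ^ (-((l : ℤ) + m)) := by
    rw [Nat.cast_succ, show -(((l : ℤ) + 1) + m) = -((l : ℤ) + m) - 1 by ring, zpow_sub_one₀ hz0]
    ring
  simp only [I0]
  rw [hint, p1]
  field_simp

/-- **(2.41)' for `I_z^{(0)}`** (`z ≥ 1`):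
`I0(h+1,j,k+1,l,m) = I0(h,j,k,l,m) − (z−1) I0(h,j,k+1,l,m) − I0(h,j+1,k,l,m)`. [cite: RhinViola2005, (2.41) and p. 409] -/
theorem I0_succ_h_succ_k {z : ℝ} (hz : 1 ≤ z) (h j k l m : ℕ) :
    I0 z (h + 1) j (k + 1) l m = I0 z h j k l m - (z - 1) * I0 z h j (k + 1) l m - I0 z h (j + 1) k l m := by
  have h1 := integrableOn_integrand hz h j k l m
  have h2 := integrableOn_integrand hz h j (k + 1) l m
  have h3 := integrableOn_integrand hz h (j + 1) k l m
  have hint : ∫ p in unitSquare, integrand z (h + 1) j (k + 1) l m p =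
      (∫ p in unitSquare, integrand z h j k l m p)
        - (z - 1) * (∫ p in unitSquare, integrand z h j (k + 1) l m p)
        - ∫ p in unitSquare, integrand z h (j + 1) k l m p := by
    calc ∫ p in unitSquare, integrand z (h + 1) j (k + 1) l m p
        = ∫ p in unitSquare, (integrand z h j k l m p - (z - 1) * integrand z h j (k + 1) l m p
            - integrand z h (j + 1) k l m p) :=
          setIntegral_congr_fun measurableSet_unitSquare fun p _ => integrand_succ_h_succ_k z h j k l m p
      _ = (∫ p in unitSquare, (integrand z h j k l m p - (z - 1) * integrand z h j (k + 1) l m p))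
            - ∫ p in unitSquare, integrand z h (j + 1) k l m p :=
          integral_sub (h1.sub (h2.const_mul (z - 1))) h3
      _ = _ := by rw [integral_sub h1 (h2.const_mul (z - 1)), MeasureTheory.integral_const_mul]
  simp only [I0]
  rw [hint]
  ring

/-! ### (2.29)' and (2.41)' for the inner residue, `I_z^{(1)}` and `I_z` -/

/-- **Pointwise (2.29)' for the inner residue** (`x ≠ z`): from `x(1−Y) = (z−x)(Y−y₀)·… `, precisely
`x·(1−Y) = D − Yz` read through the residue at `y₀ = x/(x−z)`,
`x·innerRes(j+1,k,l+1,m) = innerRes(j,k,l,m) − z·innerRes(j,k+1,l,m)`. [cite: RhinViola2005, (2.29) and p. 408] -/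
theorem mul_innerRes_succ_j_succ_l {x z : ℝ} (hxz : x ≠ z) (j k l m : ℕ) :
    x * innerRes z (j + 1) k (l + 1) m x = innerRes z j k l m x - z * innerRes z j (k + 1) l m x := by
  have hxz' : x - z ≠ 0 := sub_ne_zero.2 hxz
  have hzx : z - x ≠ 0 := sub_ne_zero.2 (Ne.symm hxz)
  set y₀ : ℝ := x / (x - z) with hy₀
  set g : ℝ[X] := X ^ k * (1 - X) ^ l with hg
  have hTX : taylor y₀ (X : ℝ[X]) = X + C y₀ := by rw [taylor_X]
  -- the key scalar identity `x (1 − y₀) = −z y₀`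
  have hsc : x * (1 - y₀) = -(z * y₀) := by
    rw [hy₀]; field_simp; ring
  by_cases hm : m ≤ j + k + 1
  swap
  · rw [innerRes_of_lt (by omega), innerRes_of_lt (by omega), innerRes_of_lt (by omega)]
    ring
  -- the two order-`(e+1)` residues, `e = j+k+1-m`
  set e : ℕ := j + k + 1 - m with he
  have hm1 : m ≤ j + 1 + k := by omega
  have hm2 : m ≤ j + (k + 1) := by omega
  have e1 : innerRes z (j + 1) k (l + 1) m x = (taylor y₀ g * (1 - taylor y₀ X)).coeff e / (z - x) ^ (e + 1) := by
    rw [innerRes_eq_taylor_coeff hm1, show j + 1 + k - m = e by omega, pow_succ (1 - (X : ℝ[X])) l,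
      ← mul_assoc, ← hg, taylor_mul, map_sub, taylor_one, C_1]
  have e2 : innerRes z j (k + 1) l m x = (taylor y₀ g * taylor y₀ X).coeff e / (z - x) ^ (e + 1) := by
    rw [innerRes_eq_taylor_coeff hm2, show j + (k + 1) - m = e by omega,
      show (X : ℝ[X]) ^ (k + 1) * (1 - X) ^ l = g * X by rw [hg]; ring, taylor_mul]
  rcases Nat.eq_zero_or_pos e with he0 | hepos
  · -- edge case `m = j+k+1`: `innerRes(j,k,l,m) = 0`, the other two are simple residues
    have h0 : innerRes z j k l m x = 0 := innerRes_of_lt (z := z) (l := l) (show j + k < m by omega) x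
    rw [e1, e2, h0, he0, hTX]
    simp only [zero_add, pow_one, mul_coeff_zero, coeff_sub, coeff_one_zero, coeff_add, coeff_X_zero, coeff_C_zero]
    field_simp
    linear_combination ((taylor y₀ g).coeff 0) * hsc
  · obtain ⟨d, hd⟩ : ∃ d, e = d + 1 := ⟨e - 1, by omega⟩
    have hm0 : m ≤ j + k := by omega
    have e0 : innerRes z j k l m x = (taylor y₀ g).coeff d / (z - x) ^ (d + 1) := by
      rw [innerRes_eq_taylor_coeff hm0, show j + k - m = d by omega]
    rw [e1, e2, e0, hd, hTX]
    have c1 : (taylor y₀ g * (1 - (X + C y₀))).coeff (d + 1) =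
        (1 - y₀) * (taylor y₀ g).coeff (d + 1) - (taylor y₀ g).coeff d := by
      rw [show (1 : ℝ[X]) - (X + C y₀) = C (1 - y₀) - X by rw [C_sub, C_1]; ring, mul_sub, coeff_sub,
        coeff_mul_X, mul_comm, coeff_C_mul]
    have c2 : (taylor y₀ g * (X + C y₀)).coeff (d + 1) =
        (taylor y₀ g).coeff d + y₀ * (taylor y₀ g).coeff (d + 1) := by
      rw [mul_add, coeff_add, coeff_mul_X, mul_comm, coeff_C_mul]
    rw [c1, c2, pow_succ (z - x) (d + 1)]
    field_simp
    linear_combination ((taylor y₀ g).coeff (d + 1)) * hsc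

/-- **Pointwise (2.41)' for the inner residue** (`x ≠ z`): `(1−x)·Y = D − (z−1)Y − x` read through the residue
at `y₀ = x/(x−z)`,
`(1−x)·innerRes(j,k+1,l,m) = innerRes(j,k,l,m) − (z−1)·innerRes(j,k+1,l,m) − x·innerRes(j+1,k,l,m)`.
[cite: RhinViola2005, (2.41) and p. 409] -/
theorem one_sub_mul_innerRes_succ_k {x z : ℝ} (hxz : x ≠ z) (j k l m : ℕ) :
    (1 - x) * innerRes z j (k + 1) l m x =
      innerRes z j k l m x - (z - 1) * innerRes z j (k + 1) l m x - x * innerRes z (j + 1) k l m x := by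
  have hxz' : x - z ≠ 0 := sub_ne_zero.2 hxz
  have hzx : z - x ≠ 0 := sub_ne_zero.2 (Ne.symm hxz)
  set y₀ : ℝ := x / (x - z) with hy₀
  set g : ℝ[X] := X ^ k * (1 - X) ^ l with hg
  have hTX : taylor y₀ (X : ℝ[X]) = X + C y₀ := by rw [taylor_X]
  -- the key scalar identity `(z − x) y₀ = −x`
  have hsc : (z - x) * y₀ = -x := by
    rw [hy₀]; field_simp; ring
  by_cases hm : m ≤ j + k + 1
  swap
  · rw [innerRes_of_lt (by omega), innerRes_of_lt (by omega), innerRes_of_lt (by omega)]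
    ring
  set e : ℕ := j + k + 1 - m with he
  have hm2 : m ≤ j + (k + 1) := by omega
  have hm3 : m ≤ j + 1 + k := by omega
  have e2 : innerRes z j (k + 1) l m x = (taylor y₀ g * taylor y₀ X).coeff e / (z - x) ^ (e + 1) := by
    rw [innerRes_eq_taylor_coeff hm2, show j + (k + 1) - m = e by omega,
      show (X : ℝ[X]) ^ (k + 1) * (1 - X) ^ l = g * X by rw [hg]; ring, taylor_mul]
  have e3 : innerRes z (j + 1) k l m x = (taylor y₀ g).coeff e / (z - x) ^ (e + 1) := by
    rw [innerRes_eq_taylor_coeff hm3, show j + 1 + k - m = e by omega]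
  rcases Nat.eq_zero_or_pos e with he0 | hepos
  · -- edge case `m = j+k+1`
    have h0 : innerRes z j k l m x = 0 := innerRes_of_lt (z := z) (l := l) (show j + k < m by omega) x
    rw [e2, e3, h0, he0, hTX]
    simp only [zero_add, pow_one, mul_coeff_zero, coeff_add, coeff_X_zero, coeff_C_zero]
    field_simp
    linear_combination ((taylor y₀ g).coeff 0) * hsc
  · obtain ⟨d, hd⟩ : ∃ d, e = d + 1 := ⟨e - 1, by omega⟩
    have hm0 : m ≤ j + k := by omega
    have e0 : innerRes z j k l m x = (taylor y₀ g).coeff d / (z - x) ^ (d + 1) := by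
      rw [innerRes_eq_taylor_coeff hm0, show j + k - m = d by omega]
    rw [e2, e3, e0, hd, hTX]
    have c2 : (taylor y₀ g * (X + C y₀)).coeff (d + 1) =
        (taylor y₀ g).coeff d + y₀ * (taylor y₀ g).coeff (d + 1) := by
      rw [mul_add, coeff_add, coeff_mul_X, mul_comm, coeff_C_mul]
    rw [c2, pow_succ (z - x) (d + 1)]
    field_simp
    linear_combination ((taylor y₀ g).coeff (d + 1)) * hsc

/-- **(2.29)' for `I_z^{(1)}`** (`z > 1`): `I1(h,j+1,k,l+1,m) = z^{−1} I1(h,j,k,l,m) − I1(h,j,k+1,l,m)`.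
[cite: RhinViola2005, (2.29) and p. 408] -/
theorem I1_succ_j_succ_l {z : ℝ} (hz : 1 < z) (h j k l m : ℕ) :
    I1 z h (j + 1) k (l + 1) m = z⁻¹ * I1 z h j k l m - I1 z h j (k + 1) l m := by
  have hz0 : z ≠ 0 := by positivity
  have i0 := intervalIntegrable_I1_integrand hz h j k l m
  have i1 := intervalIntegrable_I1_integrand hz h j (k + 1) l m
  have hint : ∫ x in (0 : ℝ)..1, x ^ (j + 1) * (1 - x) ^ h * innerRes z (j + 1) k (l + 1) m x =
      (∫ x in (0 : ℝ)..1, x ^ j * (1 - x) ^ h * innerRes z j k l m x)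
        - z * ∫ x in (0 : ℝ)..1, x ^ j * (1 - x) ^ h * innerRes z j (k + 1) l m x := by
    rw [← intervalIntegral.integral_const_mul, ← integral_sub i0 (i1.const_mul z)]
    refine integral_congr fun x hx => ?_
    have hx1 : x ≠ z := by
      rw [Set.uIcc_of_le zero_le_one] at hx
      exact fun h' => by linarith [hx.2]
    have key := mul_innerRes_succ_j_succ_l hx1 j k l m
    linear_combination x ^ j * (1 - x) ^ h * key
  have p1 : z ^ (-(((l + 1 : ℕ) : ℤ) + (m : ℤ))) = z⁻¹ * z ^ (-((l : ℤ) + m)) := by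
    rw [Nat.cast_succ, show -(((l : ℤ) + 1) + m) = -((l : ℤ) + m) - 1 by ring, zpow_sub_one₀ hz0]
    ring
  simp only [I1]
  rw [hint, p1]
  field_simp

/-- **(2.41)' for `I_z^{(1)}`** (`z > 1`):
`I1(h+1,j,k+1,l,m) = I1(h,j,k,l,m) − (z−1) I1(h,j,k+1,l,m) − I1(h,j+1,k,l,m)`. [cite: RhinViola2005, (2.41) and p. 409] -/
theorem I1_succ_h_succ_k {z : ℝ} (hz : 1 < z) (h j k l m : ℕ) :
    I1 z (h + 1) j (k + 1) l m = I1 z h j k l m - (z - 1) * I1 z h j (k + 1) l m - I1 z h (j + 1) k l m := by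
  have i0 := intervalIntegrable_I1_integrand hz h j k l m
  have i1 := intervalIntegrable_I1_integrand hz h j (k + 1) l m
  have i2 := intervalIntegrable_I1_integrand hz h (j + 1) k l m
  have hint : ∫ x in (0 : ℝ)..1, x ^ j * (1 - x) ^ (h + 1) * innerRes z j (k + 1) l m x =
      (∫ x in (0 : ℝ)..1, x ^ j * (1 - x) ^ h * innerRes z j k l m x)
        - (z - 1) * (∫ x in (0 : ℝ)..1, x ^ j * (1 - x) ^ h * innerRes z j (k + 1) l m x)
        - ∫ x in (0 : ℝ)..1, x ^ (j + 1) * (1 - x) ^ h * innerRes z (j + 1) k l m x := by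
    rw [← intervalIntegral.integral_const_mul, ← integral_sub i0 (i1.const_mul (z - 1)),
      ← integral_sub (i0.sub (i1.const_mul (z - 1))) i2]
    refine integral_congr fun x hx => ?_
    have hx1 : x ≠ z := by
      rw [Set.uIcc_of_le zero_le_one] at hx
      exact fun h' => by linarith [hx.2]
    have key := one_sub_mul_innerRes_succ_k hx1 j k l m
    linear_combination x ^ j * (1 - x) ^ h * key
  simp only [I1]
  rw [hint]
  ring

/-- **(2.29)' for `I_z = I_z^{(0)} − (log z) I_z^{(1)}`** (`z > 1`). [cite: RhinViola2005, (2.29) and p. 408] -/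
theorem I_succ_j_succ_l {z : ℝ} (hz : 1 < z) (h j k l m : ℕ) :
    I z h (j + 1) k (l + 1) m = z⁻¹ * I z h j k l m - I z h j (k + 1) l m := by
  rw [I, I, I, I0_succ_j_succ_l hz.le, I1_succ_j_succ_l hz]
  ring

/-- **(2.41)' for `I_z = I_z^{(0)} − (log z) I_z^{(1)}`** (`z > 1`). [cite: RhinViola2005, (2.41) and p. 409] -/
theorem I_succ_h_succ_k {z : ℝ} (hz : 1 < z) (h j k l m : ℕ) :
    I z (h + 1) j (k + 1) l m = I z h j k l m - (z - 1) * I z h j (k + 1) l m - I z h (j + 1) k l m := by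
  rw [I, I, I, I, I0_succ_h_succ_k hz.le, I1_succ_h_succ_k hz]
  ring

/-! ### (2.29)' and (2.41)' for `I_z^{(2)}` (polynomial-residue model) -/

/-- **(2.29)' for `I_z^{(2)}`** (`z ≠ 0`): `I2(h,j+1,k,l+1,m) = z^{−1} I2(h,j,k,l,m) − I2(h,j,k+1,l,m)`.
[cite: RhinViola2005, (2.29) and p. 408] -/
theorem I2_succ_j_succ_l {z : ℝ} (hz : z ≠ 0) (h j k l m : ℕ) :
    I2 z h (j + 1) k (l + 1) m = z⁻¹ * I2 z h j k l m - I2 z h j (k + 1) l m := by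
  obtain ⟨Ga, Na, hNa, hfa, hIa⟩ := exists_outer_rep z h (j + 1) k (l + 1) m
  obtain ⟨G₁, N₁, hN₁, hf₁, hI₁⟩ := exists_outer_rep z h j k l m
  obtain ⟨G₂, N₂, hN₂, hf₂, hI₂⟩ := exists_outer_rep z h j (k + 1) l m
  set GR : ℝ[X] := G₁ * (X - C z) ^ N₂ - z • (G₂ * (X - C z) ^ N₁) with hGR
  have hrep : ∀ x : ℝ, x ≠ z → Ga.eval x / (x - z) ^ Na = GR.eval x / (x - z) ^ (N₁ + N₂) := by
    intro x hxz
    have hxz' : x - z ≠ 0 := sub_ne_zero.2 hxz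
    have key : x ^ (j + 1) * (1 - x) ^ h * innerRes z (j + 1) k (l + 1) m x =
        x ^ j * (1 - x) ^ h * innerRes z j k l m x - z * (x ^ j * (1 - x) ^ h * innerRes z j (k + 1) l m x) := by
      have e := mul_innerRes_succ_j_succ_l hxz j k l m
      linear_combination x ^ j * (1 - x) ^ h * e
    rw [← hfa x hxz, key, hf₁ x hxz, hf₂ x hxz, hGR]
    simp only [eval_sub, eval_smul, eval_mul, eval_pow, eval_X, eval_C, smul_eq_mul]
    rw [pow_add]
    field_simp
  have hres := hasseDeriv_eval_eq_of_eval_div_eq hNa (by omega) hrep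
  have hcomb : (hasseDeriv (N₁ + N₂ - 1) GR).eval z =
      (hasseDeriv (N₁ - 1) G₁).eval z - z * (hasseDeriv (N₂ - 1) G₂).eval z := by
    rw [hGR, map_sub, LinearMap.map_smul, eval_sub, eval_smul, smul_eq_mul,
      show N₁ + N₂ - 1 = (N₁ - 1) + N₂ by omega, hasseDeriv_mul_X_sub_C_pow_eval,
      show (N₁ - 1) + N₂ = (N₂ - 1) + N₁ by omega, hasseDeriv_mul_X_sub_C_pow_eval]
  rw [hIa, hI₁, hI₂, hres, hcomb]
  have e1 : z ^ (-(((l + 1 : ℕ) : ℤ) + m)) = z⁻¹ * z ^ (-((l : ℤ) + m)) := by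
    rw [show (-(((l + 1 : ℕ) : ℤ) + m)) = -((l : ℤ) + m) - 1 by push_cast; ring, zpow_sub_one₀ hz]
    ring
  rw [e1]
  field_simp

/-- **(2.41)' for `I_z^{(2)}`** (`z ≠ 0`):
`I2(h+1,j,k+1,l,m) = I2(h,j,k,l,m) − (z−1) I2(h,j,k+1,l,m) − I2(h,j+1,k,l,m)`. [cite: RhinViola2005, (2.41) and p. 409] -/
theorem I2_succ_h_succ_k (z : ℝ) (h j k l m : ℕ) :
    I2 z (h + 1) j (k + 1) l m = I2 z h j k l m - (z - 1) * I2 z h j (k + 1) l m - I2 z h (j + 1) k l m := by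
  obtain ⟨Ga, Na, hNa, hfa, hIa⟩ := exists_outer_rep z (h + 1) j (k + 1) l m
  obtain ⟨G₁, N₁, hN₁, hf₁, hI₁⟩ := exists_outer_rep z h j k l m
  obtain ⟨G₂, N₂, hN₂, hf₂, hI₂⟩ := exists_outer_rep z h j (k + 1) l m
  obtain ⟨G₃, N₃, hN₃, hf₃, hI₃⟩ := exists_outer_rep z h (j + 1) k l m
  set GR : ℝ[X] := G₁ * (X - C z) ^ (N₂ + N₃) - (z - 1) • (G₂ * (X - C z) ^ (N₁ + N₃)) -
    G₃ * (X - C z) ^ (N₁ + N₂) with hGR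
  have hrep : ∀ x : ℝ, x ≠ z → Ga.eval x / (x - z) ^ Na = GR.eval x / (x - z) ^ (N₁ + N₂ + N₃) := by
    intro x hxz
    have hxz' : x - z ≠ 0 := sub_ne_zero.2 hxz
    have key : x ^ j * (1 - x) ^ (h + 1) * innerRes z j (k + 1) l m x =
        x ^ j * (1 - x) ^ h * innerRes z j k l m x
          - (z - 1) * (x ^ j * (1 - x) ^ h * innerRes z j (k + 1) l m x)
          - x ^ (j + 1) * (1 - x) ^ h * innerRes z (j + 1) k l m x := by
      have e := one_sub_mul_innerRes_succ_k hxz j k l m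
      linear_combination x ^ j * (1 - x) ^ h * e
    rw [← hfa x hxz, key, hf₁ x hxz, hf₂ x hxz, hf₃ x hxz, hGR]
    simp only [eval_sub, eval_smul, eval_mul, eval_pow, eval_X, eval_C, smul_eq_mul]
    rw [pow_add, pow_add, pow_add, pow_add, pow_add]
    field_simp
  have hres := hasseDeriv_eval_eq_of_eval_div_eq hNa (by omega) hrep
  have hcomb : (hasseDeriv (N₁ + N₂ + N₃ - 1) GR).eval z =
      (hasseDeriv (N₁ - 1) G₁).eval z - (z - 1) * (hasseDeriv (N₂ - 1) G₂).eval z -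
        (hasseDeriv (N₃ - 1) G₃).eval z := by
    rw [hGR, map_sub, map_sub, LinearMap.map_smul, eval_sub, eval_sub, eval_smul, smul_eq_mul,
      show N₁ + N₂ + N₃ - 1 = (N₁ - 1) + (N₂ + N₃) by omega, hasseDeriv_mul_X_sub_C_pow_eval,
      show (N₁ - 1) + (N₂ + N₃) = (N₂ - 1) + (N₁ + N₃) by omega, hasseDeriv_mul_X_sub_C_pow_eval,
      show (N₂ - 1) + (N₁ + N₃) = (N₃ - 1) + (N₁ + N₂) by omega, hasseDeriv_mul_X_sub_C_pow_eval]
  rw [hIa, hI₁, hI₂, hI₃, hres, hcomb]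
  ring

end RhinViola

end Literature.NumberTheory.DiophantineApproximation

end
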